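import Summits.BirchSwinnertonDyer.BirchSwinnertonDyer.Theorems.ThetaPartnerAtTwoSignedKatoUpToAtTwoLocalTwoSignFlip
import Summits.BirchSwinnertonDyer.BirchSwinnertonDyer.Theorems.ThetaPartnerAtTwoSignedKatoUpToAtTwoLocalTwoSignedIntersection
import Summits.BirchSwinnertonDyer.BirchSwinnertonDyer.Theorems.ThetaPartnerAtTwoSignedControlAtTwoPlusHondaTransport
import HarnessLib

/-!
# Route `ThetaPartnerAtTwo` (TP2), crux K3 `SignedKatoDivisibilityUpToAtTwo` (item stmt-BirchSwinnertonDyer-20308),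
# line `colemanrat` v3 — THE LOCAL THEORY AT `p = 2`, file 15: MODEL TRANSPORT of Kobayashi's signed groups
# `signedLocalPointsOfEmb κ ι W ε n` along an isomorphism of algebraic closures, and Prop. 8.12 ii) AT `p = 2` for the crux's
# LITERAL local objects `signedLocalPoints κ (v.adicCompletion ℚ) W (±1) n` (the completion `ℚ_v`, `v ∋ 2`, the chosen embedding
# `closureEmb`) — the groups cutting out K3's `signedSelmerInfty W κ 1` / `SignedSelmerDualData W κ γ 1`

HONEST FRAMING (cell `bsd-wall`, width seat `bsd-wall-tp2-p2x-w2` g2): THEOREMS ONLY — no definition, no named fact, no instance,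
no `sorry`; closes no item; BSD is NOT proved by any of this.

## Why this file

Files 5–14 of the K3 local series (and file 11, `w3`) prove Kobayashi's Prop. 8.12 ii) at `p = 2` over Mathlib's MODEL `ℚ_[2]`
(`PadicAlgCl 2`, the currency of the cyclotomic tower `PadicCyclotomicTower.zeta/stab`) and an ARBITRARY embedding `ι : ℚ̄ → ℚ̄₂`,
whereas Def. 1.1's Selmer group `Kobayashi2003.signedSelmerLayer W κ ε n` — hence K3 — imposes the Kummer condition cut out by
`signedLocalPoints κ (v.adicCompletion ℚ) W ε n` at the COMPLETION `ℚ_v = v.adicCompletion ℚ` of `ℚ` at the place `v ∋ 2`, with the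
CHOSEN embedding `closureEmb ℚ_v`. The K4 seats' transport engine (`SignedEC.modelMap_*`, file `…PlusHondaTransportEngine`: along
`Φ : Ē ≃ₐ[K] Ē'` over `φ : E ≃+* E'`, `ι' = Φ ∘ ι`, `T = Φ_*` on points — layer points, traces and orbits correspond) moves HONDA
systems; this file adds the SIGNED groups to the engine and moves Prop. 8.12 ii) (both halves) to (`ℚ_v`, `closureEmb`):
`Φ : ℚ̄₂ ≃ ℚ̄_v` over Mathlib's `adicCompletion.padicEquiv v`, `ι := Φ⁻¹ ∘ closureEmb`.

## What is proved

* §1 (generic `K`, `E ≃ E'`, `Φ`, `ι' = Φ ∘ ι`, `T = Φ_*`, any `κ : ZpExtension K p`) `modelMap_mem_signedLocalPointsOfEmb_iff`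
  (`T P ∈ E^ε_{ι'}(n) ↔ P ∈ E^ε_ι(n)`), `map_modelMap_signedLocalPointsOfEmb` / `map_modelMap_localLayerPointsOfEmb`
  (`T(E^ε_ι(n)) = E^ε_{ι'}(n)`, `T(E_ι(K_n·E)) = E_{ι'}(K_n·E')`), `sup_signedLocalPointsOfEmb_eq_of_model` (the generation identity
  `E⁺ ⊔ E⁻ = E(K_n·E)` transports).
* §2 (`p = 2`) **`sup_signedLocalPoints_eq_localLayerPoints_two_adicCompletion`**: for `W/ℚ` globally minimal with `GoodSS W 2`,
  `a₂(W) = 0`, the CYCLOTOMIC `κ`, the place `v ∋ 2` and every `n`: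
  `signedLocalPoints κ (v.adicCompletion ℚ) W 1 n ⊔ signedLocalPoints κ (v.adicCompletion ℚ) W (−1) n = localLayerPoints κ (v.adicCompletion ℚ) W n`
  — Prop. 8.12 ii) (generation) for the LITERAL local objects of K3; with `w3`'s intersection half
  (`SignedIntersection.signedLocalPointsOfEmb_one_inf_neg_one_eq_two_adicCompletion`) packaged as
  **`signedLocalPoints_exact_two_adicCompletion`**: Kobayashi's exact sequence (8.22)
  `0 → E(ℚ_v) → E⁺(ℚ_{n,v}) ⊕ E⁻(ℚ_{n,v}) → E(ℚ_{n,v}) → 0` AT `p = 2`, as the pair `E⁺ ⊔ E⁻ = E(ℚ_{n,v})`, `E⁺ ⊓ E⁻ = E(ℚ_v)`.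

References: [Kobayashi2003] S. Kobayashi, Invent. Math. 152 (2003), Def. 1.1 (p. 2), Prop. 8.12 ii) and (8.22) (p. 17);
[SerreGaloisCohomology1997] II.§1.1 (transport along isomorphic completions); [KuriharaOtsuki2006] p. 557.
-/

set_option autoImplicit false
-- the Theorems namespace of this sub repeats the summit name by design (D-0017 nested layout)
set_option linter.dupNamespace false

noncomputable section

open scoped Classical NumberField

universe u

namespace Summit.BirchSwinnertonDyer.BirchSwinnertonDyer.Theorems

namespace SignedKatoOffTwo.LocalTwo

open NumberField IsDedekindDomain WeierstrassCurve Literature.NumberTheory.EllipticCurves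
  Literature.NumberTheory.GaloisRepresentations Literature.NumberTheory.EllipticCurves.Rank1Residual ZpExtension
  Summit.BirchSwinnertonDyer.Rank1Residual.Additive.LocalTransport

/-! ## §1 The signed groups under model transport (generic) -/

section Generic

variable {K : Type u} [Field K] {E : Type u} [Field E] [Algebra K E] {E' : Type u} [Field E'] [Algebra K E']
  (Φ : AlgebraicClosure E ≃ₐ[K] AlgebraicClosure E') (φ : E ≃+* E')
  (hf : ∀ y : E, Φ (algebraMap E (AlgebraicClosure E) y) = algebraMap E' (AlgebraicClosure E') (φ y))
  (ι : AlgebraicClosure K →ₐ[K] AlgebraicClosure E) (ι' : AlgebraicClosure K →ₐ[K] AlgebraicClosure E')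
  (hcompat : ∀ z : AlgebraicClosure K, ι' z = Φ (ι z))
  (W : WeierstrassCurve K) (T : localPoints W E →+ localPoints W E')
  (hT : ∀ P : localPoints W E, T P =
    WeierstrassCurve.Affine.Point.map (W' := W) (Φ : AlgebraicClosure E →ₐ[K] AlgebraicClosure E')
      (show (W.baseChange (AlgebraicClosure E)).toAffine.Point from P))
  {p : ℕ} [Fact p.Prime] (κ : ZpExtension K p)

include hf hcompat hT in
/-- **Kobayashi's signed groups correspond under model transport**: `T P ∈ E^ε_{ι'}(K_n·E') ↔ P ∈ E^ε_ι(K_n·E)` — Def. 1.1's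
conditions are layer memberships of the point and of its traces, and both correspond (`SignedEC.modelMap_mem_localLayerPointsOfEmb_iff`,
`SignedEC.modelMap_localTraceOfEmb`). [cite: Kobayashi2003, Def. 1.1] [cite: SerreGaloisCohomology1997, II.§1.1] -/
theorem modelMap_mem_signedLocalPointsOfEmb_iff (ε : ℤˣ) (n : ℕ) (P : localPoints W E) :
    T P ∈ Kobayashi2003.signedLocalPointsOfEmb κ ι' W ε n ↔ P ∈ Kobayashi2003.signedLocalPointsOfEmb κ ι W ε n := by
  rw [Kobayashi2003.mem_signedLocalPointsOfEmb_iff, Kobayashi2003.mem_signedLocalPointsOfEmb_iff,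
    SignedEC.modelMap_mem_localLayerPointsOfEmb_iff Φ φ hf ι ι' hcompat W T hT κ n P]
  refine and_congr_right fun hP => forall₃_congr fun m _ _ => ?_
  rw [← SignedEC.modelMap_localTraceOfEmb Φ φ hf ι ι' hcompat W T hT κ (m + 1) n hP,
    SignedEC.modelMap_mem_localLayerPointsOfEmb_iff Φ φ hf ι ι' hcompat W T hT κ m]

include hf hcompat hT in
/-- **`T(E^ε_ι(K_n·E)) = E^ε_{ι'}(K_n·E')`** (`T` is onto: `SignedEC.modelMap_surjective`). [cite: Kobayashi2003, Def. 1.1]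
[cite: SerreGaloisCohomology1997, II.§1.1] -/
theorem map_modelMap_signedLocalPointsOfEmb (ε : ℤˣ) (n : ℕ) :
    (Kobayashi2003.signedLocalPointsOfEmb κ ι W ε n).map T = Kobayashi2003.signedLocalPointsOfEmb κ ι' W ε n := by
  ext Q
  constructor
  · rintro ⟨P, hP, rfl⟩
    exact (modelMap_mem_signedLocalPointsOfEmb_iff Φ φ hf ι ι' hcompat W T hT κ ε n P).mpr hP
  · intro hQ
    obtain ⟨P, rfl⟩ := SignedEC.modelMap_surjective Φ W T hT Q
    exact ⟨P, (modelMap_mem_signedLocalPointsOfEmb_iff Φ φ hf ι ι' hcompat W T hT κ ε n P).mp hQ, rfl⟩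

include hf hcompat hT in
/-- **`T(E_ι(K_n·E)) = E_{ι'}(K_n·E')`** (layer points; `SignedEC.modelMap_mem_localLayerPointsOfEmb_iff` + surjectivity).
[cite: Kobayashi2003, Def. 1.1] [cite: SerreGaloisCohomology1997, II.§1.1] -/
theorem map_modelMap_localLayerPointsOfEmb (n : ℕ) :
    (Kobayashi2003.localLayerPointsOfEmb κ ι W n).map T = Kobayashi2003.localLayerPointsOfEmb κ ι' W n := by
  ext Q
  constructor
  · rintro ⟨P, hP, rfl⟩
    exact (SignedEC.modelMap_mem_localLayerPointsOfEmb_iff Φ φ hf ι ι' hcompat W T hT κ n P).mpr hP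
  · intro hQ
    obtain ⟨P, rfl⟩ := SignedEC.modelMap_surjective Φ W T hT Q
    exact ⟨P, (SignedEC.modelMap_mem_localLayerPointsOfEmb_iff Φ φ hf ι ι' hcompat W T hT κ n P).mp hQ, rfl⟩

include hf hcompat hT in
/-- **The generation identity transports**: `E⁺_ι ⊔ E⁻_ι = E_ι(K_n·E)` ⟹ `E⁺_{ι'} ⊔ E⁻_{ι'} = E_{ι'}(K_n·E')` (`T` commutes with `⊔`).
[cite: Kobayashi2003, Prop. 8.12 ii) (p. 17)] [cite: SerreGaloisCohomology1997, II.§1.1] -/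
theorem sup_signedLocalPointsOfEmb_eq_of_model (n : ℕ)
    (h : Kobayashi2003.signedLocalPointsOfEmb κ ι W 1 n ⊔ Kobayashi2003.signedLocalPointsOfEmb κ ι W (-1) n =
      Kobayashi2003.localLayerPointsOfEmb κ ι W n) :
    Kobayashi2003.signedLocalPointsOfEmb κ ι' W 1 n ⊔ Kobayashi2003.signedLocalPointsOfEmb κ ι' W (-1) n =
      Kobayashi2003.localLayerPointsOfEmb κ ι' W n := by
  rw [← map_modelMap_signedLocalPointsOfEmb Φ φ hf ι ι' hcompat W T hT κ 1 n,
    ← map_modelMap_signedLocalPointsOfEmb Φ φ hf ι ι' hcompat W T hT κ (-1) n, ← AddSubgroup.map_sup, h,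
    map_modelMap_localLayerPointsOfEmb Φ φ hf ι ι' hcompat W T hT κ n]

end Generic

/-! ## §2 `p = 2`: Prop. 8.12 ii) for `signedLocalPoints κ (v.adicCompletion ℚ) W (±1) n`, `v ∋ 2`, `closureEmb` -/

section Two

open Rat.HeightOneSpectrum

/-- A finite place `v` of `ℚ` containing the rational prime `p` is the place of `p` (private copy of the K4 seats' helper in
`…PlusHondaTransport`). [folklore] -/
private theorem coe_primesEquiv_eq_of_natCast_mem' {p : ℕ} [hp : Fact p.Prime] {v : HeightOneSpectrum (𝓞 ℚ)}
    (hpv : (p : 𝓞 ℚ) ∈ v.asIdeal) : ((primesEquiv v : Nat.Primes) : ℕ) = p := by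
  have h : natGenerator v ∣ p := by
    rw [natGenerator_dvd_iff, ← map_natCast (Rat.IsIntegralClosure.intEquiv (𝓞 ℚ)) p]
    exact Ideal.mem_map_of_mem _ hpv
  exact (Nat.prime_dvd_prime_iff_eq (prime_natGenerator v) hp.out).mp h

/-- `ℚ_[p] ≃ ℚ_v` as `ℚ`-algebras at the place `v ∋ p` (Mathlib's `adicCompletion.padicEquiv`; private copy of the K4 seats'
helper). [folklore] -/
private theorem nonempty_algEquiv_padic_adicCompletion' {p : ℕ} [Fact p.Prime] {v : HeightOneSpectrum (𝓞 ℚ)}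
    (hpv : (p : 𝓞 ℚ) ∈ v.asIdeal) : Nonempty (ℚ_[p] ≃ₐ[ℚ] v.adicCompletion ℚ) := by
  obtain rfl : ((primesEquiv v : Nat.Primes) : ℕ) = p := coe_primesEquiv_eq_of_natCast_mem' hpv
  exact ⟨(adicCompletion.padicEquiv v).toAlgEquiv.symm⟩

/-- **KOBAYASHI's Prop. 8.12 ii) (GENERATION) AT `p = 2` for the LITERAL local objects of K3**: for `W/ℚ` globally minimal with
`GoodSS W 2` and `a₂(W) = 0`, `κ` the cyclotomic `ℤ₂`-extension of `ℚ`, `v` the place of `ℚ` above `2`, and every `n`: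
`signedLocalPoints κ (v.adicCompletion ℚ) W 1 n ⊔ signedLocalPoints κ (v.adicCompletion ℚ) W (−1) n = localLayerPoints κ (v.adicCompletion ℚ) W n`,
i.e. `E(ℚ_{n,v}) = E⁺(ℚ_{n,v}) + E⁻(ℚ_{n,v})` for Def. 1.1's groups at the completion `ℚ_v` with the chosen embedding `closureEmb`
— file 14's `sup_signedLocalPointsOfEmb_eq_localLayerPointsOfEmb_two_cyclotomic` over Mathlib's `ℚ_[2]` at `ι := Φ⁻¹ ∘ closureEmb`,
transported along `Φ : ℚ̄₂ ≃ ℚ̄_v` (§1). [cite: Kobayashi2003, Def. 1.1 (p. 2), Prop. 8.12 ii) (p. 17)] [cite: KuriharaOtsuki2006, p. 557] -/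
theorem sup_signedLocalPoints_eq_localLayerPoints_two_adicCompletion (W : WeierstrassCurve ℚ) [W.IsElliptic]
    [W.IsGloballyMinimal] (hss : GoodSS W 2) (ha : W.frobeniusTrace 2 = 0) {κ : ZpExtension ℚ 2} (hκ : κ.IsCyclotomic)
    (v : HeightOneSpectrum (𝓞 ℚ)) (hv : (2 : 𝓞 ℚ) ∈ v.asIdeal) (n : ℕ) :
    Kobayashi2003.signedLocalPoints κ (v.adicCompletion ℚ) W 1 n ⊔
        Kobayashi2003.signedLocalPoints κ (v.adicCompletion ℚ) W (-1) n =
      Kobayashi2003.localLayerPoints κ (v.adicCompletion ℚ) W n := by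
  obtain ⟨e⟩ := nonempty_algEquiv_padic_adicCompletion' (p := 2) (v := v) (by exact_mod_cast hv)
  -- `Φ : ℚ̄₂ ≃ ℚ̄_v` over `e`
  let Φr : AlgebraicClosure ℚ_[2] ≃+* AlgebraicClosure (v.adicCompletion ℚ) :=
    IsAlgClosure.equivOfEquiv (AlgebraicClosure ℚ_[2]) (AlgebraicClosure (v.adicCompletion ℚ)) e.toRingEquiv
  have hf : ∀ y : ℚ_[2], Φr (algebraMap ℚ_[2] (AlgebraicClosure ℚ_[2]) y) =
      algebraMap (v.adicCompletion ℚ) (AlgebraicClosure (v.adicCompletion ℚ)) (e.toRingEquiv y) :=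
    fun y ↦ IsAlgClosure.equivOfEquiv_algebraMap _ _ e.toRingEquiv y
  have hK : ∀ c : ℚ, Φr (algebraMap ℚ (AlgebraicClosure ℚ_[2]) c) = algebraMap ℚ (AlgebraicClosure (v.adicCompletion ℚ)) c := by
    intro c
    rw [eq_ratCast (algebraMap ℚ (AlgebraicClosure ℚ_[2])), eq_ratCast (algebraMap ℚ _), map_ratCast]
  let Φ : AlgebraicClosure ℚ_[2] ≃ₐ[ℚ] AlgebraicClosure (v.adicCompletion ℚ) := { Φr with commutes' := hK }
  have hΦ : ∀ x, Φ x = Φr x := fun _ ↦ rfl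
  have hf' : ∀ y : ℚ_[2], Φ (algebraMap ℚ_[2] (AlgebraicClosure ℚ_[2]) y) =
      algebraMap (v.adicCompletion ℚ) (AlgebraicClosure (v.adicCompletion ℚ)) (e.toRingEquiv y) := fun y ↦ by
    rw [hΦ, hf]
  -- `ι := Φ⁻¹ ∘ closureEmb`
  let ι : AlgebraicClosure ℚ →ₐ[ℚ] AlgebraicClosure ℚ_[2] :=
    ((Φ.symm : AlgebraicClosure (v.adicCompletion ℚ) ≃ₐ[ℚ] AlgebraicClosure ℚ_[2]) :
      AlgebraicClosure (v.adicCompletion ℚ) →ₐ[ℚ] AlgebraicClosure ℚ_[2]).comp (closureEmb (K := ℚ) (v.adicCompletion ℚ))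
  have hcompat : ∀ z, closureEmb (K := ℚ) (v.adicCompletion ℚ) z = Φ (ι z) := fun z ↦ by
    exact (Φ.apply_symm_apply _).symm
  exact sup_signedLocalPointsOfEmb_eq_of_model Φ e.toRingEquiv hf' ι (closureEmb (K := ℚ) (v.adicCompletion ℚ)) hcompat W
    (show localPoints W ℚ_[2] →+ localPoints W (v.adicCompletion ℚ) from
      WeierstrassCurve.Affine.Point.map (W' := W) (Φ : AlgebraicClosure ℚ_[2] →ₐ[ℚ] AlgebraicClosure (v.adicCompletion ℚ)))
    (fun _ ↦ rfl) κ n (sup_signedLocalPointsOfEmb_eq_localLayerPointsOfEmb_two_cyclotomic ι W hss ha hκ n)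

/-- **KOBAYASHI's exact sequence (8.22) AT `p = 2` for the LITERAL local objects of K3** — both identities of Prop. 8.12 ii) for
Def. 1.1's groups at the completion `ℚ_v` (`v ∋ 2`), chosen embedding: `E⁺(ℚ_{n,v}) ⊔ E⁻(ℚ_{n,v}) = E(ℚ_{n,v})` (generation, this file,
needs `a₂(W) = 0`) and `E⁺(ℚ_{n,v}) ⊓ E⁻(ℚ_{n,v}) = E(ℚ_v)` (directness, width seat `w3`'s file 11 via the `bsd-2adic` cell's tower
torsion), for every globally minimal `W/ℚ` with `GoodSS W 2`, `a₂(W) = 0`, `κ` cyclotomic, every `n`.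
[cite: Kobayashi2003, Prop. 8.12 ii) and (8.22) (p. 17), Def. 1.1 (p. 2)] [cite: KuriharaOtsuki2006, p. 557] -/
theorem signedLocalPoints_exact_two_adicCompletion (W : WeierstrassCurve ℚ) [W.IsElliptic] [W.IsGloballyMinimal]
    (hss : GoodSS W 2) (ha : W.frobeniusTrace 2 = 0) {κ : ZpExtension ℚ 2} (hκ : κ.IsCyclotomic)
    (v : HeightOneSpectrum (𝓞 ℚ)) (hv : (2 : 𝓞 ℚ) ∈ v.asIdeal) (n : ℕ) :
    Kobayashi2003.signedLocalPoints κ (v.adicCompletion ℚ) W 1 n ⊔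
          Kobayashi2003.signedLocalPoints κ (v.adicCompletion ℚ) W (-1) n =
        Kobayashi2003.localLayerPoints κ (v.adicCompletion ℚ) W n ∧
      Kobayashi2003.signedLocalPoints κ (v.adicCompletion ℚ) W 1 n ⊓
          Kobayashi2003.signedLocalPoints κ (v.adicCompletion ℚ) W (-1) n =
        Kobayashi2003.localLayerPoints κ (v.adicCompletion ℚ) W 0 :=
  ⟨sup_signedLocalPoints_eq_localLayerPoints_two_adicCompletion W hss ha hκ v hv n,
    SignedIntersection.signedLocalPointsOfEmb_one_inf_neg_one_eq_two_adicCompletion W hss κ v hv _ n⟩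

end Two

end SignedKatoOffTwo.LocalTwo

end Summit.BirchSwinnertonDyer.BirchSwinnertonDyer.Theorems

end
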